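import Mathlib
import Summits.AtomisticToContinuum.HydrodynamicLimit.Theorems.ImplosionDichotomyDenseExcursionPackingAnalyticDefsB
import Summits.AtomisticToContinuum.HydrodynamicLimit.Theorems.ImplosionDichotomyDenseExcursionSonicCavityDefsC
import Summits.AtomisticToContinuum.HydrodynamicLimit.Theorems.ImplosionDichotomyDenseExcursionPackingLargeRealResolventCk
import Summits.AtomisticToContinuum.HydrodynamicLimit.Theorems.ImplosionDichotomyDenseExcursionPackingResolventFarField

/-!
# Existence half of the packing-order resolvent at every order `k ≥ 1`
# (crux `DenseExcursion`, stmt-AtomisticToContinuum-12586, line `sonic-cavity-renewal` v7, stub `stub_packingResolvent`)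

Helper file (`--supports stmt-AtomisticToContinuum-12586`) for the registered stub `stub_packingResolvent` (skeleton v7,
NEW): it proves the registered helper `packingResolvent_existence` — the EXISTENCE-WITH-FINITE-GLOBAL-WEIGHTED-SUP half of
`PackingResolvent r W S` (`…PackingAnalyticDefsB`) at EVERY packing order `Λ = kμ`, `μ = 3(r − 1)`, `k ≥ 1`, on the pinned
speed window `17307/15625 ≤ r ≤ 697/625`, from `IsMonatomicProfile`, the cavity tube (clause (c): `7/10 ≤ eˣS` on
`x ≤ 1`), the weighted-`C⁵` cavity resolvent `CavityResolventCk 5` and the pinned rate `PinnedRate` (`…SonicCavityDefsC`).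

**Mathematics.** (i) INSTANTIATION. `PinnedRate` gives a smooth radial mode at some `Λ₁ ∈ [3/4, 17/20]`, and on the window
`6(r − 1) ≤ 0.6912 < 3/4`, `17/20 < 0.9688 ≤ 9(r − 1)`, so `CavityResolventCk 5` applies at `Λ₁` with one constant `C`.
At `Λ = kμ` (real, `≥ μ ≥ 0.32`): `Re Λ ≥ −1/5`, `‖Λ‖ ≥ 1/20`, `‖Λ − Λ₁‖ ≥ 1/20` (`packingOrder_avoids_pinnedRate`),
`‖Λ − r‖ ≥ 1/20` (`k = 1, 2, 3`: `3 − 2r ≥ 0.77`, `6 − 5r ≥ 0.42`, `9 − 8r ≥ 0.078`; `k ≥ 4`: `11r − 12 ≥ 0.18`).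
(ii) SOURCE. A real centre-regular source has a finite weighted `C⁵` seminorm on `x ≤ 1`
(`wCkBound_of_isRegularPair`, i.e. `iteratedDeriv_bound_of_isRegularPair`, p145502) — only finiteness is needed.
(iii) REAL PARTS of the complex solution (`isRegularPair_re`, `re_solves`, p139225) solve the same equations.
(iv) GLOBAL FINITENESS of `|u₁| + |u₂|/S`: on `x ≤ 1` from the resolvent bound `‖ŵ‖ + eˣ‖ŝ‖ ≤ C·N₅` and `eˣS ≥ 7/10`
(`|u₂|/S ≤ (10/7)eˣ‖ŝ‖`); on `x ≥ 0` by the far-field lemma `packingResolvent_farField` (p155801: every real solution of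
the forward-stable exterior system with bounded weighted source is weighted-bounded), after reading the coerced complex
equations in real form (`realEqs_of_coe`).

NOT here: the Laplace GAIN `C·N/k` for `k ≥ k₀` (the other half of `PackingResolvent`), `CavityResolventCk 5`,
`PinnedRate`, `CavityTube` themselves (hypotheses; other stubs of the line).
-/

noncomputable section

open Filter Set Topology

namespace Summit.AtomisticToContinuum.HydrodynamicLimit.Theorems.PackingAnalyticImplosion

open Summit.AtomisticToContinuum.HydrodynamicLimit.Theorems.R2OneModeTwoConditions
open Summit.AtomisticToContinuum.HydrodynamicLimit.Theorems.SonicCavityRenewal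

/-! ## The coerced complex equations in real form -/

/-- **REAL FORM OF THE COERCED RESOLVENT EQUATIONS.** For differentiable real `u₁, u₂`, the resolvent equations of
`PackingResolvent` (complex vocabulary `linW`, `linS` by coercion, real rate `Λ`, real data) are the real resolvent system
consumed by `packingResolvent_farField` (`deriv` commutes with the coercion; `Complex.ofReal` is injective). [folklore] -/
theorem realEqs_of_coe {r Λ : ℝ} {W S u₁ u₂ f₁ f₂ : ℝ → ℝ} (hu₁ : Differentiable ℝ u₁) (hu₂ : Differentiable ℝ u₂)
    (h : ∀ x, (Λ : ℂ) * (u₁ x : ℂ) - linW r W S (fun y => (u₁ y : ℂ)) (fun y => (u₂ y : ℂ)) x = (f₁ x : ℂ) ∧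
      (Λ : ℂ) * (u₂ x : ℂ) - linS r W S (fun y => (u₁ y : ℂ)) (fun y => (u₂ y : ℂ)) x = (f₂ x : ℂ)) :
    ∀ x, Λ * u₁ x - ((W x - 1) * deriv u₁ x + 3 * S x * deriv u₂ x + (deriv W x + 2 * W x - r) * u₁ x +
        (3 * deriv S x + 6 * S x) * u₂ x) = f₁ x ∧
      Λ * u₂ x - (S x / 3 * deriv u₁ x + (W x - 1) * deriv u₂ x + (deriv S x + 2 * S x) * u₁ x +
        (deriv W x / 3 + 2 * W x - r) * u₂ x) = f₂ x := by
  intro x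
  have d1 : deriv (fun y => (u₁ y : ℂ)) x = ((deriv u₁ x : ℝ) : ℂ) := ((hu₁ x).hasDerivAt.ofReal_comp).deriv
  have d2 : deriv (fun y => (u₂ y : ℂ)) x = ((deriv u₂ x : ℝ) : ℂ) := ((hu₂ x).hasDerivAt.ofReal_comp).deriv
  obtain ⟨h1, h2⟩ := h x
  unfold linW at h1
  unfold linS at h2
  rw [d1, d2] at h1 h2
  beta_reduce at h1 h2
  constructor
  · exact_mod_cast h1
  · exact_mod_cast h2

/-! ## The registered helper -/

/-- **Helper `packingResolvent_existence` of `stub_packingResolvent`: THE PACKING-ORDER RESOLVENT EXISTS AT EVERY ORDER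
WITH FINITE GLOBAL WEIGHTED SUP.** On the pinned window, for a monatomic profile in the cavity tube with the weighted-`C⁵`
cavity resolvent and the pinned rate: for every `k ≥ 1` and every smooth centre-regular real source `(f₁, f₂)` with finite
global weighted sup `|f₁| + |f₂|/S`, there is a smooth centre-regular real solution `(u₁, u₂)` of `kμ·u − Lu = f`,
`μ = 3(r − 1)`, with finite global weighted sup `|u₁| + |u₂|/S` — the real part of the `CavityResolventCk 5` solution at
`Λ = kμ` (outside the three `1/20`-discs by the window arithmetic and `packingOrder_avoids_pinnedRate`), bounded on `x ≤ 1`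
by the resolvent bound and tube (c), on `x ≥ 0` by `packingResolvent_farField`. [folklore] -/
theorem packingResolvent_existence : ∀ (r : ℝ) (W S : ℝ → ℝ), (17307 / 15625 : ℝ) ≤ r → r ≤ 697 / 625 → IsMonatomicProfile r W S → CavityTube r W S → CavityResolventCk 5 r W S → PinnedRate r W S → ∀ k : ℕ, 1 ≤ k → ∀ f₁ f₂ : ℝ → ℝ, IsRegularPair (fun x => (f₁ x : ℂ)) (fun x => (f₂ x : ℂ)) → (∃ N : ℝ, ∀ y, |f₁ y| + |f₂ y| / S y ≤ N) → ∃ u₁ u₂ : ℝ → ℝ, IsRegularPair (fun x => (u₁ x : ℂ)) (fun x => (u₂ x : ℂ)) ∧ (∀ x, (((k : ℝ) * (3 * (r - 1)) : ℝ) : ℂ) * (u₁ x : ℂ) - linW r W S (fun y => (u₁ y : ℂ)) (fun y => (u₂ y : ℂ)) x = (f₁ x : ℂ) ∧ (((k : ℝ) * (3 * (r - 1)) : ℝ) : ℂ) * (u₂ x : ℂ) - linS r W S (fun y => (u₁ y : ℂ)) (fun y => (u₂ y : ℂ)) x = (f₂ x : ℂ)) ∧ ∃ N' : ℝ, ∀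 y, |u₁ y| + |u₂ y| / S y ≤ N' := by
  intro r W S hlo hhi hP hT hres hRate k hk f₁ f₂ hf hfN
  obtain ⟨N, hN⟩ := hfN
  obtain ⟨Λ₁, h34, h1720, hmode⟩ := hRate
  obtain ⟨C, -, hsolve⟩ := hres Λ₁ (by linarith) (by linarith) hmode
  obtain ⟨N₅, hN₅⟩ := wCkBound_of_isRegularPair 5 hf
  have hSpos : ∀ x, 0 < S x := hP.2.2.2.2.1
  have hk1 : (1 : ℝ) ≤ k := by exact_mod_cast hk
  have hμ : 0 < 3 * (r - 1) := by linarith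
  have hΛμ : 3 * (r - 1) ≤ (k : ℝ) * (3 * (r - 1)) := le_mul_of_one_le_left hμ.le hk1
  have hΛpos : 0 < (k : ℝ) * (3 * (r - 1)) := lt_of_lt_of_le hμ hΛμ
  -- the four constraints of the cavity resolvent at `Λ = kμ`
  have hre : -(1 / 5 : ℝ) ≤ (((k : ℝ) * (3 * (r - 1)) : ℝ) : ℂ).re := by rw [Complex.ofReal_re]; linarith
  have hn0 : (1 / 20 : ℝ) ≤ ‖(((k : ℝ) * (3 * (r - 1)) : ℝ) : ℂ)‖ := by
    rw [Complex.norm_of_nonneg hΛpos.le]; linarith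
  have hn1 : (1 / 20 : ℝ) ≤ ‖(((k : ℝ) * (3 * (r - 1)) : ℝ) : ℂ) - (Λ₁ : ℂ)‖ := by
    rw [← Complex.ofReal_sub, Complex.norm_real, Real.norm_eq_abs]
    exact packingOrder_avoids_pinnedRate r Λ₁ k hlo hhi h34 h1720 hk
  have hnr : (1 / 20 : ℝ) ≤ ‖(((k : ℝ) * (3 * (r - 1)) : ℝ) : ℂ) - (r : ℂ)‖ := by
    rw [← Complex.ofReal_sub, Complex.norm_real, Real.norm_eq_abs]
    rcases Nat.lt_or_ge k 4 with hk4 | hk4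
    · interval_cases k
      · exact le_abs.2 (Or.inr (by push_cast; linarith))
      · exact le_abs.2 (Or.inr (by push_cast; linarith))
      · exact le_abs.2 (Or.inr (by push_cast; linarith))
    · have hk4' : (4 : ℝ) ≤ k := by exact_mod_cast hk4
      have h12 : 4 * (3 * (r - 1)) ≤ (k : ℝ) * (3 * (r - 1)) := mul_le_mul_of_nonneg_right hk4' hμ.le
      exact le_abs.2 (Or.inl (by linarith))
  -- solve with the weighted-`C⁵` cavity resolvent and take real parts
  obtain ⟨ŵ, ŝ, hreg, heqC, hbd, -⟩ := hsolve _ hre hn0 hn1 hnr (fun x => (f₁ x : ℂ)) (fun x => (f₂ x : ℂ)) hf N₅ hN₅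
  have hŵ1 : Differentiable ℝ ŵ := hreg.1.differentiable (by simp)
  have hŝ1 : Differentiable ℝ ŝ := hreg.2.1.differentiable (by simp)
  have hueq : ∀ x, (((k : ℝ) * (3 * (r - 1)) : ℝ) : ℂ) * ((((ŵ x).re : ℝ)) : ℂ) -
      linW r W S (fun y => (((ŵ y).re : ℝ) : ℂ)) (fun y => (((ŝ y).re : ℝ) : ℂ)) x = (f₁ x : ℂ) ∧
      (((k : ℝ) * (3 * (r - 1)) : ℝ) : ℂ) * ((((ŝ x).re : ℝ)) : ℂ) -
      linS r W S (fun y => (((ŵ y).re : ℝ) : ℂ)) (fun y => (((ŝ y).re : ℝ) : ℂ)) x = (f₂ x : ℂ) :=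
    fun x => re_solves hŵ1 hŝ1 heqC x
  refine ⟨fun x => (ŵ x).re, fun x => (ŝ x).re, isRegularPair_re hreg, hueq, ?_⟩
  -- global finiteness of the weighted sup
  have hu₁d : Differentiable ℝ fun x => (ŵ x).re :=
    fun x => (Complex.reCLM.hasFDerivAt.comp_hasDerivAt x (hŵ1 x).hasDerivAt).differentiableAt
  have hu₂d : Differentiable ℝ fun x => (ŝ x).re :=
    fun x => (Complex.reCLM.hasFDerivAt.comp_hasDerivAt x (hŝ1 x).hasDerivAt).differentiableAt
  have hreal := realEqs_of_coe hu₁d hu₂d hueq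
  obtain ⟨N₁, hN₁⟩ := packingResolvent_farField r ((k : ℝ) * (3 * (r - 1))) W S (fun x => (ŵ x).re)
    (fun x => (ŝ x).re) f₁ f₂ hP hΛpos hu₁d hu₂d hreal N (fun y _ => hN y)
  obtain ⟨-, -, -, -, -, -, -, -, hc, -, -⟩ := hT
  refine ⟨max (10 / 7 * (C * N₅)) N₁, fun y => ?_⟩
  rcases le_or_gt y 1 with hy | hy
  · have hb := hbd y hy
    have h7 := (hc y hy).1
    have hSy := hSpos y
    have h1 : |(ŵ y).re| ≤ ‖ŵ y‖ := Complex.abs_re_le_norm _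
    have h2 : |(ŝ y).re| ≤ ‖ŝ y‖ := Complex.abs_re_le_norm _
    have h3 : |(ŝ y).re| / S y ≤ 10 / 7 * (Real.exp y * ‖ŝ y‖) := by
      rw [div_le_iff₀ hSy]
      calc |(ŝ y).re| ≤ ‖ŝ y‖ := h2
        _ = ‖ŝ y‖ * 1 := by ring
        _ ≤ ‖ŝ y‖ * (10 / 7 * (Real.exp y * S y)) := mul_le_mul_of_nonneg_left (by linarith) (norm_nonneg _)
        _ = 10 / 7 * (Real.exp y * ‖ŝ y‖) * S y := by ring
    have h4 : ‖ŵ y‖ ≤ 10 / 7 * ‖ŵ y‖ := by linarith [norm_nonneg (ŵ y)]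
    refine le_trans ?_ (le_max_left _ _)
    show |(ŵ y).re| + |(ŝ y).re| / S y ≤ 10 / 7 * (C * N₅)
    linarith
  · exact le_trans (hN₁ y (by linarith)) (le_max_right _ _)

end Summit.AtomisticToContinuum.HydrodynamicLimit.Theorems.PackingAnalyticImplosion

end
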